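import Summits.ABC.IUTFork.Repair.RHQ3L0Exact
import Summits.ABC.IUTFork.Repair.RHInSigmaDatum
import Literature.IUT.LogVolume.LogSeriesDominantTerm
import Literature.IUT.LogVolume.UnitLogMaxNorm
import HarnessLib

/-!
# D-0079 RESCUE sub-cell R-H, ROUND 2 Q3 — row 8 «heightclass» (Σ₈) on the l-axis of a genuine datum: NO TIES IN THE TAIL, the INPUT-FREE exact
# criterion, the tail theorem with the untied certificate DISCHARGED, and fibre uniformity for `K/ℚ` Galois (seat abc-iut-rh2-q3-typ-1 g2)

PROOF-ONLY companion (0 definitions) of `RHQ3LTailBand` p473493 (abc-iut-rh2-q3-typ-1 g0: `hBand_pilotDataOfK_of_ltail`, binders untied-certificate `h₀` +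
fibre-uniformity `hunif` + tail test) and `RHQ3L0Exact` p477373 (abc-iut-rh-typ-2 g3: `strictMinPow_of_piece`, `not_strictMinPow_of_tie`, `topCell_iff_quad_nonneg`,
`hBand_pilotDataOfK_iff_quad` with inputs `he : e_w = e_v·l`, `hP : m_q(w) = P`). Rung LADDER-ABC:A2.RESCUE.H; ROUND2/START-HERE §2 «rh2-q3-typ-1 … «datum(k) ∈
Σ₈/Σ₁₅ ⇔ l ≥ l₀(k, p, e_w)»». TAKES NO SIDE on [IUTchIII] Cor. 3.12 or on any author; nothing here asserts abc; `StrictMinPow`/`CertVal`/`HBand` (abc-iut-rh-typ-8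
p459046) and `InSigma8 D := HBand (pilotDataOfK D K)` (abc-iut-rh2-xi-2 p470383) are row 8's CANDIDATE vocabulary consumed BY NAME; «in Σ₈» = the hypothesis H⋆₈
holds as typed, never «S holds».

WHAT THIS FILE ADDS (the genuine l-axis facts that remove the inputs):
* §1 `strictMinPow_of_strictTurning` — the TURNING-POINT form (`∀ a < a₀, p^a(p−1) < e`, `e < p^{a₀}(p−1)`, the currency of abc-iut-c312-3's `LogEnvelope`)
  of abc-iut-rh-typ-2's `strictMinPow_of_piece`, via abc-iut-w5-d017's `RamificationCriterion.exponent_min_strict`; `forall_ne_tie_of_prime_dvd` — a prime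
  `l > p` dividing `e` EXCLUDES every tie `e = p^a(p−1)`; `exists_strictMinPow_of_forall_ne`.
* §2 `bandTop_iff_quadratic` — the ℝ twin (real `ε`, `m`) of `Q3L0Exact.topCell_iff_quad_nonneg` (`4·(RHS − LHS) = a·l² + b·l + c`); `not_band_fallback`.
* §3 at the GENUINE datum `Cor312Prov.pilotDataOfK D K`: `l_dvd_ramIdx_placeOf` (`l ∣ e_w` at every bad place, [IUTchI] Ex. 3.2 (iv) — so `ε := e_w/l ∈ ℕ`
  discharges `Q3L0Exact`'s input `he` with `e_v := e_w/l`); `forall_ne_tie_placeOf_of_lt` / `exists_strictMinPow_placeOf_of_lt` (`p < l` ⟹ the bad place is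
  UNTIED: ties live only at primes `l < p`); **`not_inSigma8_of_tie`** — ONE tied bad place puts the datum OUTSIDE Σ₈ (no untied branch; the fallback
  `r = e_w ≥ 5` fails the cell since `P_q(w) ≥ 1`); **`inSigma8_iff_topQuadratic`** — INPUT-FREE exact criterion: on strict pieces `t(w)`, `InSigma8 D` IFF
  at every bad `w | p`: `p > 2`, uniform fibre, and `0 ≤ a·l² + b·l + c` with `ε := e_w/l`, `m := P_q(w)`, `P := p^{t(w)}` (reals;
  `a = 2(1+t)ε − m`, `b = 2m + 2(t−1)ε − 2P`, `c = 3m + 4 − 2P` — abc-iut-rh-num-1's `q3exact.py` / `Q3-L0EXACT-rh-num-1.tsv` f61504e3e8b20ab6);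
  **`inSigma8_of_ltail`** — g0's tail theorem with `h₀` DISCHARGED (the tail test `p^t ≤ l ∧ ord_v(q_v) + 4e(v|p) ≤ 4e(v|p)t` forces `p ≤ l`, Def. 3.1 (b)(c)
  gives `p ≠ l`, so `p < l ∣ e_w`): only `hunif` remains; **`ramIdx_placeOf_eq_of_isGalois`** — `hunif` is a THEOREM for `K/ℚ` Galois (Mathlib
  `Ideal.ramificationIdx_eq_of_isGaloisGroup`); **`inSigma8_of_ltail_of_isGalois`** — for such data the per-place tail test ALONE gives `InSigma8 D`.
Q3(row 8) word unchanged: YES-PER-CURVE on Galois/uniform data with `l₀` exponential in the local height (the per-curve target `LTailSigma8` is typed in the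
companion definition file); numerics of record rh-num-1 / rh2-q3-num.
[cite: Mochizuki2012, IUTchI Def. 3.1 (b)(c) pp. 61–62, Ex. 3.2 (iv) p. 71; IUTchIV Prop. 1.2 (i)(ii) p. 10, Prop. 1.4 p. 13]
[cite: NeukirchANT1999, Ch. II Prop. (5.5), Prop. (6.8)] [cite: DupuyHilado2025, §3.3, §3.4] [claim: Mochizuki2012, status: disputed] for every IUT locution.
-/

noncomputable section

open Set Function NumberField IsDedekindDomain

namespace Summit.ABC.IUTFork.Repair.RH.Q3LTailSigma8

open Literature.IUT.LogThetaLattice Literature.IUT.LogVolume Literature.IUT.HodgeTheaters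
open Summit.ABC.IUTFork.Thm311 Summit.ABC.IUTFork.Thm311.Real Summit.ABC.IUTFork.Cor312Prov Summit.ABC.IUTFork.Repair.RHHeightClass
  Summit.ABC.IUTFork.Repair.RH.Q3LTailBand

/-! ## §1. The untied outer exponent `r♯(p, e)` on its piece (integer currency) -/

section Piece

/-- **STRICT PIECE ⟹ UNTIED CERTIFICATE.** If `p^a·(p−1) < e` for all `a < a₀` and `e < p^{a₀}·(p−1)` (the open piece
`p^{a₀−1}(p−1) < e < p^{a₀}(p−1)`), then `r♯ := p^{a₀} − a₀·e` is the STRICT minimum: `RHHeightClass.StrictMinPow p e (p^{a₀} − a₀·e)` — the converse of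
`RHHeightClassGlue.strictTurning_of_strictMin`, turning-point twin of abc-iut-rh-typ-2's `Q3L0Exact.strictMinPow_of_piece`; via abc-iut-w5-d017's
`RamificationCriterion.exponent_min_strict` (integer gap `≥ 1`).
[cite: NeukirchANT1999, Ch. II Prop. (5.5)] -/
theorem strictMinPow_of_strictTurning {p e a₀ : ℕ} (hp : 2 ≤ p)
    (hlo : ∀ a < a₀, (p : ℤ) ^ a * ((p : ℤ) - 1) < e) (hhi : (e : ℤ) < (p : ℤ) ^ a₀ * ((p : ℤ) - 1)) :
    StrictMinPow p e ((p : ℤ) ^ a₀ - a₀ * e) := by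
  have hP : (2 : ℤ) ≤ (p : ℤ) := by exact_mod_cast hp
  refine ⟨a₀, rfl, fun t ht => ?_⟩
  have h := RamificationCriterion.exponent_min_strict (S := 1) (P := (p : ℤ)) (E := (e : ℤ)) (a₀ := a₀) le_rfl hP
    (fun a ha => by rw [one_mul]; exact hlo a ha) (by rw [one_mul]; exact hhi) ht
  rw [one_mul, one_mul] at h
  linarith

/-- **A prime `l > p` dividing `e` rules out every tie**: `l ∣ e = p^a(p−1)` would give `l ∣ p` or `l ≤ p − 1`. On the genuine l-axis
(`l ∣ e_w`, `RHQ3LTail`) there is therefore NO tied bad place once `l > p`. [folklore] -/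
theorem forall_ne_tie_of_prime_dvd {p e l : ℕ} (hp : p.Prime) (hl : l.Prime) (hpl : p < l) (hle : l ∣ e) :
    ∀ a : ℕ, (e : ℤ) ≠ (p : ℤ) ^ a * ((p : ℤ) - 1) := by
  intro a h
  have hcast : ((p ^ a * (p - 1) : ℕ) : ℤ) = (p : ℤ) ^ a * ((p : ℤ) - 1) := by
    push_cast [Nat.cast_sub hp.one_le]
    ring
  have h' : e = p ^ a * (p - 1) := by
    have : (e : ℤ) = ((p ^ a * (p - 1) : ℕ) : ℤ) := by rw [hcast]; exact h
    exact_mod_cast this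
  rw [h'] at hle
  rcases (Nat.Prime.dvd_mul hl).mp hle with h1 | h1
  · have h2 : l ∣ p := hl.dvd_of_dvd_pow h1
    have h3 : l = p := (Nat.prime_dvd_prime_iff_eq hl hp).mp h2
    omega
  · have h2 : l ≤ p - 1 := Nat.le_of_dvd (by have := hp.two_le; omega) h1
    omega

/-- **Off the ties an untied certificate EXISTS**, at the strict turning point (abc-iut-c312-3's `LogEnvelope.exists_strict_turning_of_forall_ne` +
`strictMinPow_of_strictTurning`). [cite: NeukirchANT1999, Ch. II Prop. (5.5)] -/
theorem exists_strictMinPow_of_forall_ne {p : ℕ} [hp : Fact p.Prime] {e : ℕ}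
    (hne : ∀ a : ℕ, (e : ℤ) ≠ (p : ℤ) ^ a * ((p : ℤ) - 1)) :
    ∃ a₀ : ℕ, (∀ a < a₀, (p : ℤ) ^ a * ((p : ℤ) - 1) < e) ∧ (e : ℤ) < (p : ℤ) ^ a₀ * ((p : ℤ) - 1) ∧
      StrictMinPow p e ((p : ℤ) ^ a₀ - a₀ * e) := by
  obtain ⟨a₀, hlo, hhi⟩ := LogEnvelope.exists_strict_turning_of_forall_ne (p := p) hne
  exact ⟨a₀, hlo, hhi, strictMinPow_of_strictTurning hp.out.two_le hlo hhi⟩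

end Piece

/-! ## §2. The top band cell as a quadratic in `l` (real currency, the currency of `HBand`) -/

section Quadratic

/-- **THE TOP CELL IS A QUADRATIC IN `l`.** With `l = 2j + 1`, `e = ε·l`, `r = P − t·e`:
`(j² − 1)·m ≤ j·(e − r) + (1 − r)  ⟺  0 ≤ (2(1+t)ε − m)·l² + (2m + 2(t−1)ε − 2P)·l + (3m + 4 − 2P)` — indeed
`4·(RHS − LHS) = a·l² + b·l + c`. rh-num-1's `q3exact.py` recipe (`a, b, c` verbatim), any reals `ε, m, P, t`. [folklore] -/
theorem bandTop_iff_quadratic (ε m P t : ℝ) (j : ℕ) :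
    (((j : ℝ)) ^ 2 - 1) * m ≤ (j : ℝ) * (ε * (2 * j + 1) - (P - t * (ε * (2 * j + 1)))) + (1 - (P - t * (ε * (2 * j + 1))))
      ↔ 0 ≤ (2 * (1 + t) * ε - m) * (2 * (j : ℝ) + 1) ^ 2 + (2 * m + 2 * (t - 1) * ε - 2 * P) * (2 * (j : ℝ) + 1)
            + (3 * m + 4 - 2 * P) := by
  have key : (2 * (1 + t) * ε - m) * (2 * (j : ℝ) + 1) ^ 2 + (2 * m + 2 * (t - 1) * ε - 2 * P) * (2 * (j : ℝ) + 1)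
        + (3 * m + 4 - 2 * P)
      = 4 * ((j : ℝ) * (ε * (2 * j + 1) - (P - t * (ε * (2 * j + 1)))) + (1 - (P - t * (ε * (2 * j + 1))))
          - (((j : ℝ)) ^ 2 - 1) * m) := by ring
  rw [key]
  constructor <;> intro h <;> linarith

/-- **The FALLBACK cell fails.** With the recipe's tie fallback `r := e` the band cell reads `(j²−1)·m ≤ 1 − e`, impossible once `0 ≤ (j²−1)·m` and
`2 ≤ e` (every genuine bad place: `e_w ≥ l ≥ 5`, `m_q ≥ 1`). [folklore] -/
theorem not_band_fallback {e m c : ℝ} (he : 2 ≤ e) (hm : 0 ≤ m) (hc : 1 ≤ c) :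
    ¬ (c ^ 2 - 1) * m ≤ c * (e - e) + (1 - e) := by
  intro h
  have : 0 ≤ (c ^ 2 - 1) * m := mul_nonneg (by nlinarith) hm
  linarith

end Quadratic

/-! ## §3. The genuine `K`-level datum: ties, the exact Σ₈ criterion, and the tail with the untied certificate discharged -/

section Genuine

variable {F K Fbar : Type} [Field F] [NumberField F] [Field K] [NumberField K] [Algebra F K] [Field Fbar]
  [Algebra F Fbar] [Algebra K Fbar] {E : WeierstrassCurve F} [E.IsElliptic] {l : ℕ} {Pb : BadPlacePredicates K}
  (D : InitialThetaData F K Fbar E l Pb)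

/-- **`l ∣ e_w` at every bad place of the genuine datum** (`e_w = e(v|p)·e(w|v)` and `l ∣ e(w|v)`, [IUTchI] Ex. 3.2 (iv):
`ThetaData.l_dvd_ramificationIdx_of_under_mem_VFbad`, `absRamificationIdx_eq_ramIdx_mul`). So `ε_w := e_w / l ∈ ℕ` — the `ε` of §2.
[cite: Mochizuki2012, IUTchI Ex. 3.2 (iv) p. 71] [claim: Mochizuki2012, status: disputed] -/
theorem l_dvd_ramIdx_placeOf (pp : Nat.Primes) (w : (thetaIndex (pilotDataOfK D K)).Fibre (.inr pp))
    (hw : haveI : Fact (pp : ℕ).Prime := ⟨pp.2⟩; placeOf (pilotDataOfK D K) pp.1 w ∈ (pilotDataOfK D K).S) :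
    haveI : Fact (pp : ℕ).Prime := ⟨pp.2⟩
    l ∣ ramIdx K (placeOf (pilotDataOfK D K) pp.1 w) := by
  haveI hF : Fact (pp : ℕ).Prime := ⟨pp.2⟩
  set w₀ := placeOf (pilotDataOfK D K) pp.1 w with hw₀
  have hVF : FinitePlace.mk (finBelow F K w₀) ∈ D.VFbad := (mem_pilotDataOfK_S_iff D K w₀).mp hw
  rw [ramIdx_eq K w₀, ThetaData.absRamificationIdx_eq_ramIdx_mul (F := F) w₀]
  exact (ThetaData.l_dvd_ramificationIdx_of_under_mem_VFbad D hVF).mul_left _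

/-- **`p < l` ⟹ the bad place is NOT tied** (`l ∣ e_w`, `forall_ne_tie_of_prime_dvd`). In the l-tail (`l >` every bad `p`) the recipe's `(tie)`
branch is EMPTY. [cite: Mochizuki2012, IUTchI Ex. 3.2 (iv) p. 71] [claim: Mochizuki2012, status: disputed] -/
theorem forall_ne_tie_placeOf_of_lt (pp : Nat.Primes) (w : (thetaIndex (pilotDataOfK D K)).Fibre (.inr pp))
    (hw : haveI : Fact (pp : ℕ).Prime := ⟨pp.2⟩; placeOf (pilotDataOfK D K) pp.1 w ∈ (pilotDataOfK D K).S)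
    (hpl : (pp : ℕ) < l) :
    haveI : Fact (pp : ℕ).Prime := ⟨pp.2⟩
    ∀ a : ℕ, ((ramIdx K (placeOf (pilotDataOfK D K) pp.1 w) : ℕ) : ℤ) ≠ ((pp : ℕ) : ℤ) ^ a * (((pp : ℕ) : ℤ) - 1) :=
  forall_ne_tie_of_prime_dvd pp.2 D.l_prime hpl (l_dvd_ramIdx_placeOf D pp w hw)

/-- **`p < l` ⟹ an UNTIED certificate exists at the bad place**, at its strict turning point: `StrictMinPow p e_w (p^{a₀} − a₀·e_w)` with
`p^a(p−1) < e_w < p^{a₀}(p−1)` (`a < a₀`). [cite: NeukirchANT1999, Ch. II Prop. (5.5)] [claim: Mochizuki2012, status: disputed] -/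
theorem exists_strictMinPow_placeOf_of_lt (pp : Nat.Primes) (w : (thetaIndex (pilotDataOfK D K)).Fibre (.inr pp))
    (hw : haveI : Fact (pp : ℕ).Prime := ⟨pp.2⟩; placeOf (pilotDataOfK D K) pp.1 w ∈ (pilotDataOfK D K).S)
    (hpl : (pp : ℕ) < l) :
    haveI : Fact (pp : ℕ).Prime := ⟨pp.2⟩
    ∃ a₀ : ℕ, (∀ a < a₀, ((pp : ℕ) : ℤ) ^ a * (((pp : ℕ) : ℤ) - 1) < ramIdx K (placeOf (pilotDataOfK D K) pp.1 w)) ∧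
      ((ramIdx K (placeOf (pilotDataOfK D K) pp.1 w) : ℕ) : ℤ) < ((pp : ℕ) : ℤ) ^ a₀ * (((pp : ℕ) : ℤ) - 1) ∧
      StrictMinPow pp (ramIdx K (placeOf (pilotDataOfK D K) pp.1 w))
        (((pp : ℕ) : ℤ) ^ a₀ - a₀ * (ramIdx K (placeOf (pilotDataOfK D K) pp.1 w) : ℕ)) := by
  haveI hF : Fact (pp : ℕ).Prime := ⟨pp.2⟩
  exact exists_strictMinPow_of_forall_ne (p := (pp : ℕ)) (forall_ne_tie_placeOf_of_lt D pp w hw hpl)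

/-- **ONE TIED BAD PLACE PUTS THE DATUM OUTSIDE Σ₈.** If some bad place `w | p` of the genuine datum has `e_w = p^a·(p−1)` (a tie: only
possible at the finitely many primes `l < p`, `forall_ne_tie_placeOf_of_lt`), then `¬ InSigma8 D`: at `w` the clause `∃ r, CertVal p e_w r ∧ cell(r)`
has no untied branch (`not_strictMinPow_of_tie`), and the fallback `r = e_w` fails the cell (`not_band_fallback`: `P_q(w) ≥ 1`, `e_w ≥ l ≥ 5`).
[cite: Mochizuki2012, IUTchI Def. 3.1 (c) p. 62, Ex. 3.2 (iv) p. 71] [claim: Mochizuki2012, status: disputed] -/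
theorem not_inSigma8_of_tie (pp : Nat.Primes) (w : (thetaIndex (pilotDataOfK D K)).Fibre (.inr pp))
    (hw : haveI : Fact (pp : ℕ).Prime := ⟨pp.2⟩; placeOf (pilotDataOfK D K) pp.1 w ∈ (pilotDataOfK D K).S)
    (a : ℕ) (htie : haveI : Fact (pp : ℕ).Prime := ⟨pp.2⟩;
      ((ramIdx K (placeOf (pilotDataOfK D K) pp.1 w) : ℕ) : ℤ) = ((pp : ℕ) : ℤ) ^ a * (((pp : ℕ) : ℤ) - 1)) :
    ¬ RH.InSigmaDatum.InSigma8 D := by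
  haveI hF : Fact (pp : ℕ).Prime := ⟨pp.2⟩
  intro h
  rw [RH.InSigmaDatum.inSigma8_iff] at h
  have hls : 2 ≤ (pilotDataOfK D K).lstar := (pilotDataOfK D K).two_le_lstar
  obtain ⟨-, -, r, hr, hcell⟩ := h pp ⟨1, by omega⟩ w hw
  set w₀ := placeOf (pilotDataOfK D K) pp.1 w with hw₀
  -- no untied branch at a tie: `r = e_w`
  have hr' : r = (ramIdx K w₀ : ℕ) := by
    rcases hr with hr | hr
    · exact absurd hr (Q3L0Exact.not_strictMinPow_of_tie pp.2.two_le htie r)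
    · exact hr
  -- `e_w ≥ l ≥ 5`, `P_q(w) ≥ 1`
  set v := finBelow F K w₀ with hv
  have hVF : FinitePlace.mk v ∈ D.VFbad := (mem_pilotDataOfK_S_iff D K w₀).mp hw
  have htower : w₀.asIdeal.ramificationIdx ℤ = ramIdx F v * Ideal.ramificationIdx' v.asIdeal w₀.asIdeal :=
    ThetaData.absRamificationIdx_eq_ramIdx_mul (F := F) w₀
  have he5 : 5 ≤ ramIdx K w₀ := by
    rw [ramIdx_eq K w₀, htower]
    have h1 : 5 ≤ Ideal.ramificationIdx' v.asIdeal w₀.asIdeal := ThetaData.five_le_ramificationIdx_of_under_mem_VFbad D hVF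
    have h2 : 0 < ramIdx F v := Nat.pos_of_ne_zero (ramIdx_ne_zero F v)
    exact h1.trans (Nat.le_mul_of_pos_left _ h2)
  have hq : 1 ≤ (pilotDataOfK D K).qPilot w₀ := one_le_qPilot_pilotDataOfK D hw
  have he5R : (5 : ℝ) ≤ ((ramIdx K w₀ : ℕ) : ℝ) := by exact_mod_cast he5
  rw [hr'] at hcell
  push_cast at hcell
  norm_num at hcell
  linarith

/-- **THE EXACT Σ₈ CRITERION AT THE GENUINE DATUM.** Suppose every bad place `w | p` of `pilotDataOfK D K` sits on a STRICT piece
`t(w)`: `p^a(p−1) < e_w` for `a < t(w)` and `e_w < p^{t(w)}(p−1)` (always the case for `l > p`, `exists_strictMinPow_placeOf_of_lt`). Then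
`InSigma8 D` holds IF AND ONLY IF at every bad `w | p`: `p > 2`, the fibre of `K` over `p` is ramification-UNIFORM, and
`0 ≤ a·l² + b·l + c` with `ε = e_w / l`, `m = P_q(w)`, `P = p^{t(w)}`, `a = 2(1+t)ε − m`, `b = 2m + 2(t−1)ε − 2P`, `c = 3m + 4 − 2P` (reals) —
`hBand_iff_cells_of_strictMin` (the certified `r` IS `r♯ = p^t − t·e_w`) + `band_le_of_top` (the top label `j = l⋆` binds, `r♯ ≤ 1 ≤ e_w`) +
`bandTop_iff_quadratic` (`e_w = ε·l`, `l = 2l⋆ + 1`). This is rh-num-1's exact l₀ recipe as a kernel sentence: the NEG primes `l` of a datum are the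
admissible `l` on whose active pieces the quadratic is negative. [cite: Mochizuki2012, IUTchI Def. 3.1 (b)(c) pp. 61–62, Ex. 3.2 (iv) p. 71;
IUTchIV Prop. 1.2 (i)(ii) p. 10] [claim: Mochizuki2012, status: disputed] -/
theorem inSigma8_iff_topQuadratic
    (tt : ∀ pp : Nat.Primes, (thetaIndex (pilotDataOfK D K)).Fibre (.inr pp) → ℕ)
    (hlo : ∀ (pp : Nat.Primes) (w : (thetaIndex (pilotDataOfK D K)).Fibre (.inr pp)),
      haveI : Fact (pp : ℕ).Prime := ⟨pp.2⟩
      placeOf (pilotDataOfK D K) pp.1 w ∈ (pilotDataOfK D K).S →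
        ∀ a < tt pp w, ((pp : ℕ) : ℤ) ^ a * (((pp : ℕ) : ℤ) - 1) < ramIdx K (placeOf (pilotDataOfK D K) pp.1 w))
    (hhi : ∀ (pp : Nat.Primes) (w : (thetaIndex (pilotDataOfK D K)).Fibre (.inr pp)),
      haveI : Fact (pp : ℕ).Prime := ⟨pp.2⟩
      placeOf (pilotDataOfK D K) pp.1 w ∈ (pilotDataOfK D K).S →
        ((ramIdx K (placeOf (pilotDataOfK D K) pp.1 w) : ℕ) : ℤ) < ((pp : ℕ) : ℤ) ^ tt pp w * (((pp : ℕ) : ℤ) - 1)) :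
    RH.InSigmaDatum.InSigma8 D ↔
      ∀ (pp : Nat.Primes) (w : (thetaIndex (pilotDataOfK D K)).Fibre (.inr pp)),
        haveI : Fact (pp : ℕ).Prime := ⟨pp.2⟩
        placeOf (pilotDataOfK D K) pp.1 w ∈ (pilotDataOfK D K).S →
          2 < (pp : ℕ) ∧
          (∀ w' : (thetaIndex (pilotDataOfK D K)).Fibre (.inr pp),
              ramIdx K (placeOf (pilotDataOfK D K) pp.1 w') = ramIdx K (placeOf (pilotDataOfK D K) pp.1 w)) ∧
          0 ≤ (2 * (1 + (tt pp w : ℝ)) * ((ramIdx K (placeOf (pilotDataOfK D K) pp.1 w) : ℝ) / l)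
                  - (pilotDataOfK D K).qPilot (placeOf (pilotDataOfK D K) pp.1 w)) * (l : ℝ) ^ 2
              + (2 * (pilotDataOfK D K).qPilot (placeOf (pilotDataOfK D K) pp.1 w)
                  + 2 * ((tt pp w : ℝ) - 1) * ((ramIdx K (placeOf (pilotDataOfK D K) pp.1 w) : ℝ) / l)
                  - 2 * ((pp : ℕ) : ℝ) ^ (tt pp w)) * (l : ℝ)
              + (3 * (pilotDataOfK D K).qPilot (placeOf (pilotDataOfK D K) pp.1 w) + 4 - 2 * ((pp : ℕ) : ℝ) ^ (tt pp w)) := by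
  -- the untied certificate at every bad place, at its value `r♯ = p^t − t·e_w`
  have h₀ : ∀ (pp : Nat.Primes) (w : (thetaIndex (pilotDataOfK D K)).Fibre (.inr pp)),
      haveI : Fact (pp : ℕ).Prime := ⟨pp.2⟩
      placeOf (pilotDataOfK D K) pp.1 w ∈ (pilotDataOfK D K).S →
        StrictMinPow pp (ramIdx K (placeOf (pilotDataOfK D K) pp.1 w))
          (((pp : ℕ) : ℤ) ^ tt pp w - (tt pp w) * (ramIdx K (placeOf (pilotDataOfK D K) pp.1 w) : ℕ)) :=
    fun pp w hw => strictMinPow_of_strictTurning pp.2.two_le (hlo pp w hw) (hhi pp w hw)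
  rw [RH.InSigmaDatum.inSigma8_iff,
    hBand_iff_cells_of_strictMin (pilotDataOfK D K) (fun pp w =>
      haveI : Fact (pp : ℕ).Prime := ⟨pp.2⟩
      ((pp : ℕ) : ℤ) ^ tt pp w - (tt pp w) * (ramIdx K (placeOf (pilotDataOfK D K) pp.1 w) : ℕ)) h₀]
  have hls2 : 2 ≤ (pilotDataOfK D K).lstar := (pilotDataOfK D K).two_le_lstar
  have hleq : l = 2 * (pilotDataOfK D K).lstar + 1 := by
    have := (pilotDataOfK D K).l_eq
    rwa [pilotDataOfK_l] at this
  have hlR : (l : ℝ) = 2 * (((pilotDataOfK D K).lstar : ℕ) : ℝ) + 1 := by exact_mod_cast hleq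
  have hl0 : (l : ℝ) ≠ 0 := by
    have : 5 ≤ l := D.five_le_l
    exact_mod_cast (show l ≠ 0 by omega)
  -- the quadratic identity at `j = l⋆`, `ε = e_w / l` (so `ε·(2l⋆+1) = e_w`)
  have hq : ∀ (E q P t : ℝ),
      ((((pilotDataOfK D K).lstar : ℕ) : ℝ) ^ 2 - 1) * q ≤
          (((pilotDataOfK D K).lstar : ℕ) : ℝ) * (E - (P - t * E)) + (1 - (P - t * E)) ↔
        0 ≤ (2 * (1 + t) * (E / l) - q) * (l : ℝ) ^ 2 + (2 * q + 2 * (t - 1) * (E / l) - 2 * P) * (l : ℝ)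
              + (3 * q + 4 - 2 * P) := by
    intro E q P t
    have h := bandTop_iff_quadratic (E / l) q P t (pilotDataOfK D K).lstar
    rw [← hlR, div_mul_cancel₀ E hl0] at h
    exact h
  constructor
  · intro h pp w hw
    haveI hF : Fact (pp : ℕ).Prime := ⟨pp.2⟩
    obtain ⟨hp2, hunif, hcell⟩ := h pp ⟨(pilotDataOfK D K).lstar - 1, by omega⟩ w hw
    refine ⟨hp2, hunif, ?_⟩
    set w₀ := placeOf (pilotDataOfK D K) pp.1 w with hw₀
    have hj : ((((pilotDataOfK D K).lstar - 1 : ℕ)) : ℝ) + 1 = (((pilotDataOfK D K).lstar : ℕ) : ℝ) := by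
      rw [Nat.cast_sub (show 1 ≤ (pilotDataOfK D K).lstar by omega)]
      push_cast
      ring
    apply (hq _ _ _ _).1
    simp only [hj] at hcell
    push_cast at hcell ⊢
    convert hcell using 2
  · intro h pp i w hw
    haveI hF : Fact (pp : ℕ).Prime := ⟨pp.2⟩
    obtain ⟨hp2, hunif, hquad⟩ := h pp w hw
    refine ⟨hp2, hunif, ?_⟩
    set w₀ := placeOf (pilotDataOfK D K) pp.1 w with hw₀
    -- the top cell from the quadratic
    have htop := (hq _ _ _ _).2 hquad
    -- the top label binds: `r♯ ≤ 1 ≤ e_w`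
    have hr1 : ((((pp : ℕ) : ℤ) ^ tt pp w - (tt pp w) * (ramIdx K w₀ : ℕ) : ℤ) : ℝ) ≤ 1 := by
      have := strictMinPow_le_one (h₀ pp w hw)
      exact_mod_cast this
    have he1 : (1 : ℝ) ≤ ((ramIdx K w₀ : ℕ) : ℝ) := by
      exact_mod_cast Nat.one_le_iff_ne_zero.2 (ramIdx_ne_zero K w₀)
    have hi1 : 1 ≤ (i : ℕ) + 1 := by omega
    have hiJ : (i : ℕ) + 1 ≤ (pilotDataOfK D K).lstar := by have := i.2; omega
    have htop' : ((((pilotDataOfK D K).lstar : ℕ) : ℝ) ^ 2 - 1) * (pilotDataOfK D K).qPilot w₀ ≤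
        (((pilotDataOfK D K).lstar : ℕ) : ℝ) * (((ramIdx K w₀ : ℕ) : ℝ)
            - ((((pp : ℕ) : ℤ) ^ tt pp w - (tt pp w) * (ramIdx K w₀ : ℕ) : ℤ) : ℝ))
          + (1 - ((((pp : ℕ) : ℤ) ^ tt pp w - (tt pp w) * (ramIdx K w₀ : ℕ) : ℤ) : ℝ)) := by
      push_cast
      convert htop using 2
    have hband := band_le_of_top (m := (pilotDataOfK D K).qPilot w₀) hr1 he1 hi1 hiJ htop'
    push_cast at hband ⊢
    convert hband using 2

/-- **ROW 8 IN THE l-TAIL, UNTIED CERTIFICATE DISCHARGED.** abc-iut-rh2-q3-typ-1 g0's `RH.Q3LTailBand.hBand_pilotDataOfK_of_ltail` with the binder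
`h₀` (an untied `StrictMinPow` certificate at every bad place) REMOVED: the tail test `p^t ≤ l ∧ ord_v(q_v) + 4e(v|p) ≤ 4e(v|p)·t` forces `t ≥ 1`,
so `p ≤ l`; [IUTchI] Def. 3.1 (b)(c) gives `p ≠ l` (`Cor312Prov.ne_two_and_ne_l_of_placeOf_mem_S_pilotDataOfK`); hence `p < l ∣ e_w`, no tie, and the
strict turning point certifies `r♯` (`exists_strictMinPow_placeOf_of_lt`). What remains is the fibre-UNIFORMITY binder of `HBand`'s band form.
[cite: Mochizuki2012, IUTchI Def. 3.1 (b)(c) pp. 61–62, Ex. 3.2 (iv) p. 71; IUTchIV Prop. 1.2 (i)(ii) p. 10] [claim: Mochizuki2012, status: disputed] -/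
theorem inSigma8_of_ltail
    (hunif : ∀ (pp : Nat.Primes) (w w' : (thetaIndex (pilotDataOfK D K)).Fibre (.inr pp)),
      haveI : Fact (pp : ℕ).Prime := ⟨pp.2⟩
      placeOf (pilotDataOfK D K) pp.1 w ∈ (pilotDataOfK D K).S →
        ramIdx K (placeOf (pilotDataOfK D K) pp.1 w') = ramIdx K (placeOf (pilotDataOfK D K) pp.1 w))
    (htail : ∀ (pp : Nat.Primes) (w : (thetaIndex (pilotDataOfK D K)).Fibre (.inr pp)),
      haveI : Fact (pp : ℕ).Prime := ⟨pp.2⟩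
      placeOf (pilotDataOfK D K) pp.1 w ∈ (pilotDataOfK D K).S →
        ∃ t : ℕ, (pp : ℕ) ^ t ≤ l ∧
          qParamOrd E (finBelow F K (placeOf (pilotDataOfK D K) pp.1 w)) + 4 * ramIdx F (finBelow F K (placeOf (pilotDataOfK D K) pp.1 w)) ≤
            4 * ramIdx F (finBelow F K (placeOf (pilotDataOfK D K) pp.1 w)) * t) :
    RH.InSigmaDatum.InSigma8 D := by
  classical
  rw [RH.InSigmaDatum.inSigma8_iff]
  -- `p < l` at every bad place
  have hpl : ∀ (pp : Nat.Primes) (w : (thetaIndex (pilotDataOfK D K)).Fibre (.inr pp)),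
      haveI : Fact (pp : ℕ).Prime := ⟨pp.2⟩
      placeOf (pilotDataOfK D K) pp.1 w ∈ (pilotDataOfK D K).S → (pp : ℕ) < l := by
    intro pp w hw
    haveI : Fact (pp : ℕ).Prime := ⟨pp.2⟩
    obtain ⟨t, hpt, hn⟩ := htail pp w hw
    have hne := (ne_two_and_ne_l_of_placeOf_mem_S_pilotDataOfK D pp w hw).2
    have ht1 : 1 ≤ t := by
      by_contra h0
      have : t = 0 := by omega
      subst this
      have he : 1 ≤ ramIdx F (finBelow F K (placeOf (pilotDataOfK D K) pp.1 w)) :=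
        Nat.one_le_iff_ne_zero.2 (ramIdx_ne_zero F _)
      omega
    have hple : (pp : ℕ) ≤ l := le_trans (by
      calc (pp : ℕ) = (pp : ℕ) ^ 1 := (pow_one _).symm
        _ ≤ (pp : ℕ) ^ t := Nat.pow_le_pow_right pp.2.pos ht1) hpt
    omega
  -- choose the untied certificate at each bad place (any value elsewhere)
  let r₀ : ∀ pp : Nat.Primes, (thetaIndex (pilotDataOfK D K)).Fibre (.inr pp) → ℤ := fun pp w =>
    haveI : Fact (pp : ℕ).Prime := ⟨pp.2⟩
    if hw : placeOf (pilotDataOfK D K) pp.1 w ∈ (pilotDataOfK D K).S then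
      ((pp : ℕ) : ℤ) ^ (exists_strictMinPow_placeOf_of_lt D pp w hw (hpl pp w hw)).choose
        - (exists_strictMinPow_placeOf_of_lt D pp w hw (hpl pp w hw)).choose * (ramIdx K (placeOf (pilotDataOfK D K) pp.1 w) : ℕ)
    else 0
  refine hBand_pilotDataOfK_of_ltail D r₀ (fun pp w hw => ?_) hunif htail
  haveI : Fact (pp : ℕ).Prime := ⟨pp.2⟩
  have h := (exists_strictMinPow_placeOf_of_lt D pp w hw (hpl pp w hw)).choose_spec.2.2
  simp only [r₀, dif_pos hw]
  exact h

/-- **Fibre uniformity is a THEOREM for `K/ℚ` Galois**: all places of `K` over `p` share one absolute ramification index (transitivity of `Gal(K/ℚ)`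
on the primes over `p`; Mathlib `Ideal.ramificationIdx_eq_of_isGaloisGroup`). [cite: NeukirchANT1999, Ch. II Prop. (6.8), §9] -/
theorem ramIdx_placeOf_eq_of_isGalois [IsGalois ℚ K] {X : PilotData K} (pp : Nat.Primes)
    (w w' : (thetaIndex X).Fibre (.inr pp)) :
    haveI : Fact (pp : ℕ).Prime := ⟨pp.2⟩
    ramIdx K (placeOf X pp.1 w') = ramIdx K (placeOf X pp.1 w) := by
  haveI hF : Fact (pp : ℕ).Prime := ⟨pp.2⟩
  set x := placeOf X pp.1 w with hx
  set x' := placeOf X pp.1 w' with hx'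
  have h1 : residueChar K x = (pp : ℕ) := residueChar_eq_of_natCast_mem (pp : ℕ) (natCast_mem_placeOf X pp.1 w)
  have h1' : residueChar K x' = (pp : ℕ) := residueChar_eq_of_natCast_mem (pp : ℕ) (natCast_mem_placeOf X pp.1 w')
  haveI : x.asIdeal.LiesOver (Ideal.span {((pp : ℕ) : ℤ)}) := by rw [← h1]; exact liesOver_residueChar K x
  haveI : x'.asIdeal.LiesOver (Ideal.span {((pp : ℕ) : ℤ)}) := by rw [← h1']; exact liesOver_residueChar K x'
  rw [ramIdx_eq K x, ramIdx_eq K x']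
  exact Ideal.ramificationIdx_eq_of_isGaloisGroup (Ideal.span {((pp : ℕ) : ℤ)}) x'.asIdeal x.asIdeal (K ≃ₐ[ℚ] K)

/-- **ROW 8 IN THE l-TAIL FOR `K/ℚ` GALOIS — NO residual binder.** For a Def. 3.1 datum whose `K = F(E_F[l])` is Galois over `ℚ` (every HEX λ_k /
Frey–Legendre row of record: `F_mod = ℚ`), the per-place tail test ALONE (`p^t ≤ l`, `ord_v(q_v) + 4e(v|p) ≤ 4e(v|p)·t`) gives `InSigma8 D`.
[cite: Mochizuki2012, IUTchI Def. 3.1 (b)(c) pp. 61–62, Ex. 3.2 (iv) p. 71; IUTchIV Prop. 1.2 (i)(ii) p. 10] [claim: Mochizuki2012, status: disputed] -/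
theorem inSigma8_of_ltail_of_isGalois [IsGalois ℚ K]
    (htail : ∀ (pp : Nat.Primes) (w : (thetaIndex (pilotDataOfK D K)).Fibre (.inr pp)),
      haveI : Fact (pp : ℕ).Prime := ⟨pp.2⟩
      placeOf (pilotDataOfK D K) pp.1 w ∈ (pilotDataOfK D K).S →
        ∃ t : ℕ, (pp : ℕ) ^ t ≤ l ∧
          qParamOrd E (finBelow F K (placeOf (pilotDataOfK D K) pp.1 w)) + 4 * ramIdx F (finBelow F K (placeOf (pilotDataOfK D K) pp.1 w)) ≤
            4 * ramIdx F (finBelow F K (placeOf (pilotDataOfK D K) pp.1 w)) * t) :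
    RH.InSigmaDatum.InSigma8 D :=
  inSigma8_of_ltail D (fun pp w w' _ => ramIdx_placeOf_eq_of_isGalois pp w w') htail

end Genuine

end Summit.ABC.IUTFork.Repair.RH.Q3LTailSigma8

end
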